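import Summits.CriticalPhenomena.SAWScalingLimit.Theorems.SAWTotalPositivityBoundaryTP2Defs
import Summits.CriticalPhenomena.SAWScalingLimit.Theorems.SAWTotalPositivityBoundaryTP2Kernel
import Summits.CriticalPhenomena.SAWScalingLimit.Theorems.SAWTotalPositivityBoundaryTP2LadderKernelsInterior
import Summits.CriticalPhenomena.SAWScalingLimit.Theorems.EdgeOfPositivity.Negative.EdgeOfPositivityRectDomain
import HarnessLib

/-!
# Crux `BoundaryTP2` (stmt-CriticalPhenomena-7115), line `Sketch`: three bottom sites and a top
site beyond them on a ladder, crossing pairing vs adjacent pairing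

Tool stub `stub_ladder_bbbt_adjacent` of the line's skeleton: on the ladder
`R_L = discreteDomainGraph (rectDomain L 1) 1` (sites `{0..L} × {0,1}`), for bottom sites
`(c₁,0), (c₂,0), (c₃,0)` and a top site `(c₄,1)` with `c₁ < c₂ < c₃ < c₄ ≤ L`, and every fugacity
`0 ≤ x ≤ 1/2`, the crossing pairing weighs at most the adjacent one:

  `Z((c₁,0),(c₃,0)) Z((c₂,0),(c₄,1)) ≤ Z((c₁,0),(c₂,0)) Z((c₃,0),(c₄,1))`,  `Z = pathKernel R_L x`.

Proof. By the landed two-point kernels of the ladder (`stub_ladderKernels_interior`) the kernels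
have the rank-two form (`P = 1+x`, `M = 1-x`, `n + 1 = j - i`, `E_k = Σ_{d<k} x^{2d+3}`,
`a_i = P + E_i`, `a'_i = M - E_i`, `b_j = P + E_{L-j}`, `b'_j = M - E_{L-j}`)

  `Z((i,0),(j,0)) = x^{n+1}/2 · (a_i b_j P^n + a'_i b'_j M^n)`,
  `Z((i,0),(j,1)) = x^{n+1}/2 · (a_i b_j P^n - a'_i b'_j M^n)`

(`ladderBbbt_kernel_same`, `ladderBbbt_kernel_mixed`, `ring` identities). Since
`E_k (1-x²) ≤ x³`, `0 ≤ E_k ≤ 1/6` on `[0, 1/2]`, so `a', b' ≥ 0`, `a' P ≤ a M`, `b' P ≤ b M`,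
`M^n ≤ P^n`. Hence, with `A = a b P^n` the main part:
* same-row brackets `B = A + a' b' M^n` satisfy `A ≤ B` and `B P² ≤ A (P² + M²)`;
* mixed brackets `D = A - a' b' M^n` satisfy `D ≤ A` and `4x A = (P² - M²) A ≤ D P²`.
Bounding the two crossing kernels above and the two adjacent kernels below (and using
`a_{c₂} ≤ a_{c₃}`, `b_{c₃} ≤ b_{c₂}`: `E_k` is monotone in `k`), the claim reduces to the scalar
inequality `(xP)^{2m+2} (P² + M²) ≤ 4x` (`m + 1 = c₃ - c₂`), i.e. (as `xP ≤ 1`)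
`x (1+x)² (2 + 2x²) ≤ 4` on `[0, 1/2]` (value `45/16` at `x = 1/2`).
-/

noncomputable section

namespace Summit.CriticalPhenomena.SAWScalingLimit.Theorems.BoundaryTP2

open Literature.Probability.LatticeModels Literature.Probability.RandomPlanarGeometry
open Summit.CriticalPhenomena.SAWScalingLimit.Theorems.EdgeOfPositivity.Negative
open scoped ENNReal

/-! ## The excursion sums `E_k = Σ_{d<k} x^{2d+3}` -/

-- adapted from `…BoundaryTP2LadderBottomRowAdjacent` (`ladderAdj_E_*`)

/-- `E_k ≥ 0` for `x ≥ 0`. [folklore] -/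
private theorem ladderBbbt_E_nonneg {x : ℝ} (hx : 0 ≤ x) (k : ℕ) :
    0 ≤ ∑ d ∈ Finset.range k, x ^ (2 * d + 3) :=
  Finset.sum_nonneg fun _ _ => pow_nonneg hx _

/-- Telescoping: `E_k (1 - x²) + x^{2k+3} = x³`. [folklore] -/
private theorem ladderBbbt_E_telescope (x : ℝ) (k : ℕ) :
    (∑ d ∈ Finset.range k, x ^ (2 * d + 3)) * (1 - x ^ 2) + x ^ (2 * k + 3) = x ^ 3 := by
  induction k with
  | zero => simp
  | succ k ih =>
    rw [Finset.sum_range_succ]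
    linear_combination ih

/-- Powers of `x ∈ [0, 1/2]` are at most the powers of `1/2`. [folklore] -/
private theorem ladderBbbt_pow_le {x : ℝ} (hx0 : 0 ≤ x) (hx : x ≤ 1 / 2) (n : ℕ) :
    x ^ n ≤ (1 / 2) ^ n :=
  pow_le_pow_left₀ hx0 hx n

/-- `E_k ≤ 1/6` for `0 ≤ x ≤ 1/2` (from `E_k (1 - x²) ≤ x³ ≤ 1/8` and `1 - x² ≥ 3/4`).
[folklore] -/
private theorem ladderBbbt_E_le {x : ℝ} (hx0 : 0 ≤ x) (hx : x ≤ 1 / 2) (k : ℕ) :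
    ∑ d ∈ Finset.range k, x ^ (2 * d + 3) ≤ 1 / 6 := by
  have h := ladderBbbt_E_telescope x k
  have hE := ladderBbbt_E_nonneg hx0 k
  have hk : 0 ≤ x ^ (2 * k + 3) := pow_nonneg hx0 _
  have hx2 := ladderBbbt_pow_le hx0 hx 2
  have hx3 := ladderBbbt_pow_le hx0 hx 3
  norm_num at hx2 hx3
  nlinarith [mul_nonneg hE (by linarith : (0 : ℝ) ≤ 1 / 4 - x ^ 2)]

/-- `E_k` is monotone in `k` for `x ≥ 0`. [folklore] -/
private theorem ladderBbbt_E_mono {x : ℝ} (hx : 0 ≤ x) {k l : ℕ} (hkl : k ≤ l) :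
    ∑ d ∈ Finset.range k, x ^ (2 * d + 3) ≤ ∑ d ∈ Finset.range l, x ^ (2 * d + 3) :=
  Finset.sum_le_sum_of_subset_of_nonneg (Finset.range_mono hkl) fun _ _ _ => pow_nonneg hx _

/-! ## The rank-two form of the ladder kernels from a bottom site -/

/-- Bottom-row kernels of the ladder `{0..L}×{0,1}` in rank-two form: for `i + n + 1 = j ≤ L` and
`x ≥ 0`, `Z_{R_L}((i,0),(j,0)) = x^{n+1}/2 · (a_i b_j (1+x)^n + a'_i b'_j (1-x)^n)` with
`a_i = 1+x+E_i`, `a'_i = 1-x-E_i`, `b_j = 1+x+E_{L-j}`, `b'_j = 1-x-E_{L-j}` (a regrouping of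
`stub_ladderKernels_interior`). [folklore] -/
private theorem ladderBbbt_kernel_same (L i j n : ℕ) (hn : i + n + 1 = j) (hjL : j ≤ L) {x : ℝ}
    (hx : 0 ≤ x) :
    pathKernel (discreteDomainGraph (rectDomain L 1) 1) x (st i 0) (st j 0) =
      ENNReal.ofReal (x ^ (n + 1) / 2 *
        ((1 + x + ∑ d ∈ Finset.range i, x ^ (2 * d + 3)) *
              (1 + x + ∑ d ∈ Finset.range (L - j), x ^ (2 * d + 3)) * (1 + x) ^ n +
          (1 - x - ∑ d ∈ Finset.range i, x ^ (2 * d + 3)) *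
              (1 - x - ∑ d ∈ Finset.range (L - j), x ^ (2 * d + 3)) * (1 - x) ^ n)) := by
  -- adapted from `ladderAdj_kernel` in `…BoundaryTP2LadderBottomRowAdjacent`
  rw [stub_ladderKernels_interior L i j (by omega) hjL hx 0 0 (Or.inl rfl) (Or.inl rfl),
    if_pos rfl]
  congr 1
  subst hn
  have e1 : i + n + 1 - i = n + 1 := by omega
  have e2 : n + 1 - 1 = n := rfl
  rw [e1, e2]
  ring

/-- Bottom-to-top kernels of the ladder `{0..L}×{0,1}` in rank-two form: for `i + n + 1 = j ≤ L`
and `x ≥ 0`, `Z_{R_L}((i,0),(j,1)) = x^{n+1}/2 · (a_i b_j (1+x)^n - a'_i b'_j (1-x)^n)` (same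
notation; the sign `ε = -1` of `stub_ladderKernels_interior` for endpoints on different rows).
[folklore] -/
private theorem ladderBbbt_kernel_mixed (L i j n : ℕ) (hn : i + n + 1 = j) (hjL : j ≤ L) {x : ℝ}
    (hx : 0 ≤ x) :
    pathKernel (discreteDomainGraph (rectDomain L 1) 1) x (st i 0) (st j 1) =
      ENNReal.ofReal (x ^ (n + 1) / 2 *
        ((1 + x + ∑ d ∈ Finset.range i, x ^ (2 * d + 3)) *
              (1 + x + ∑ d ∈ Finset.range (L - j), x ^ (2 * d + 3)) * (1 + x) ^ n -
          (1 - x - ∑ d ∈ Finset.range i, x ^ (2 * d + 3)) *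
              (1 - x - ∑ d ∈ Finset.range (L - j), x ^ (2 * d + 3)) * (1 - x) ^ n)) := by
  rw [stub_ladderKernels_interior L i j (by omega) hjL hx 0 1 (Or.inl rfl) (Or.inr rfl),
    if_neg (by norm_num : (0 : ℤ) ≠ 1)]
  congr 1
  subst hn
  have e1 : i + n + 1 - i = n + 1 := by omega
  have e2 : n + 1 - 1 = n := rfl
  rw [e1, e2]
  ring

/-! ## Real inequalities in the rank-two variables -/

/-- The main part `a b (1+x)^k` of a bracket is nonnegative. [folklore] -/
private theorem ladderBbbt_main_nonneg {x e f : ℝ} (k : ℕ) (hx0 : 0 ≤ x) (he : 0 ≤ e)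
    (hf : 0 ≤ f) : 0 ≤ (1 + x + e) * (1 + x + f) * (1 + x) ^ k := by
  positivity

/-- Lower bound of a same-row bracket: `a b P^k ≤ a b P^k + a' b' M^k` (`a', b', M ≥ 0` for
`x ≤ 1/2`, `e, f ≤ 1/6`). [folklore] -/
private theorem ladderBbbt_bracket_lower {x e f : ℝ} (k : ℕ) (hx : x ≤ 1 / 2) (he : e ≤ 1 / 6)
    (hf : f ≤ 1 / 6) :
    (1 + x + e) * (1 + x + f) * (1 + x) ^ k ≤
      (1 + x + e) * (1 + x + f) * (1 + x) ^ k + (1 - x - e) * (1 - x - f) * (1 - x) ^ k :=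
  le_add_of_nonneg_right
    (mul_nonneg (mul_nonneg (by linarith) (by linarith)) (pow_nonneg (by linarith) k))

/-- A same-row bracket is nonnegative. [folklore] -/
private theorem ladderBbbt_bracket_nonneg {x e f : ℝ} (k : ℕ) (hx0 : 0 ≤ x) (hx : x ≤ 1 / 2)
    (he0 : 0 ≤ e) (he : e ≤ 1 / 6) (hf0 : 0 ≤ f) (hf : f ≤ 1 / 6) :
    0 ≤ (1 + x + e) * (1 + x + f) * (1 + x) ^ k + (1 - x - e) * (1 - x - f) * (1 - x) ^ k :=
  (ladderBbbt_main_nonneg k hx0 he0 hf0).trans (ladderBbbt_bracket_lower k hx he hf)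

/-- The rank-two form of a same-row kernel is nonnegative. [folklore] -/
private theorem ladderBbbt_form_nonneg {x e f : ℝ} (k : ℕ) (hx0 : 0 ≤ x) (hx : x ≤ 1 / 2)
    (he0 : 0 ≤ e) (he : e ≤ 1 / 6) (hf0 : 0 ≤ f) (hf : f ≤ 1 / 6) :
    0 ≤ x ^ (k + 1) / 2 *
      ((1 + x + e) * (1 + x + f) * (1 + x) ^ k + (1 - x - e) * (1 - x - f) * (1 - x) ^ k) :=
  mul_nonneg (by positivity) (ladderBbbt_bracket_nonneg k hx0 hx he0 he hf0 hf)

/-- Upper bound of a same-row bracket: `(a b P^k + a' b' M^k) P² ≤ a b P^k (P² + M²)`, from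
`a' P ≤ a M`, `b' P ≤ b M` and `M^k ≤ P^k`. [folklore] -/
private theorem ladderBbbt_bracket_upper {x e f : ℝ} (k : ℕ) (hx0 : 0 ≤ x) (hx : x ≤ 1 / 2)
    (he0 : 0 ≤ e) (hf0 : 0 ≤ f) (hf : f ≤ 1 / 6) :
    ((1 + x + e) * (1 + x + f) * (1 + x) ^ k + (1 - x - e) * (1 - x - f) * (1 - x) ^ k) *
        (1 + x) ^ 2 ≤
      (1 + x + e) * (1 + x + f) * (1 + x) ^ k * ((1 + x) ^ 2 + (1 - x) ^ 2) := by
  -- adapted from `ladderAdj_bracket_upper` in `…BoundaryTP2LadderBottomRowAdjacent`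
  have h1 : (1 - x - e) * (1 + x) ≤ (1 + x + e) * (1 - x) := by nlinarith
  have h2 : (1 - x - f) * (1 + x) ≤ (1 + x + f) * (1 - x) := by nlinarith
  have h3 : (1 - x) ^ k ≤ (1 + x) ^ k := pow_le_pow_left₀ (by linarith) (by linarith) k
  have key : (1 - x - e) * (1 + x) * ((1 - x - f) * (1 + x)) * (1 - x) ^ k ≤
      (1 + x + e) * (1 - x) * ((1 + x + f) * (1 - x)) * (1 + x) ^ k :=
    mul_le_mul (mul_le_mul h1 h2 (mul_nonneg (by linarith) (by linarith))
      (mul_nonneg (by linarith) (by linarith))) h3 (pow_nonneg (by linarith) k)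
      (mul_nonneg (mul_nonneg (by linarith) (by linarith)) (mul_nonneg (by linarith) (by linarith)))
  nlinarith [key]

/-- Upper bound of a mixed bracket: `a b P^k - a' b' M^k ≤ a b P^k` (`a', b', M ≥ 0`).
[folklore] -/
private theorem ladderBbbt_diff_upper {x e f : ℝ} (k : ℕ) (hx : x ≤ 1 / 2) (he : e ≤ 1 / 6)
    (hf : f ≤ 1 / 6) :
    (1 + x + e) * (1 + x + f) * (1 + x) ^ k - (1 - x - e) * (1 - x - f) * (1 - x) ^ k ≤
      (1 + x + e) * (1 + x + f) * (1 + x) ^ k :=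
  sub_le_self _ (mul_nonneg (mul_nonneg (by linarith) (by linarith)) (pow_nonneg (by linarith) k))

/-- A mixed bracket is nonnegative: `a' b' M^k ≤ a b P^k` termwise (`a' ≤ a`, `0 ≤ b' ≤ b`,
`0 ≤ M ≤ P`). [folklore] -/
private theorem ladderBbbt_diff_nonneg {x e f : ℝ} (k : ℕ) (hx0 : 0 ≤ x) (hx : x ≤ 1 / 2)
    (he0 : 0 ≤ e) (hf0 : 0 ≤ f) (hf : f ≤ 1 / 6) :
    0 ≤ (1 + x + e) * (1 + x + f) * (1 + x) ^ k - (1 - x - e) * (1 - x - f) * (1 - x) ^ k :=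
  sub_nonneg.2
    (mul_le_mul (mul_le_mul (by linarith) (by linarith) (by linarith) (by linarith))
      (pow_le_pow_left₀ (by linarith) (by linarith) k) (pow_nonneg (by linarith) k)
      (mul_nonneg (by linarith) (by linarith)))

/-- Lower bound of a mixed bracket: `4x · a b P^k ≤ (a b P^k - a' b' M^k) P²`, i.e.
`a' b' M^k P² ≤ a b P^k M²` (from `a' P ≤ a M`, `b' P ≤ b M`, `M^k ≤ P^k`) together with
`P² - M² = 4x`. [folklore] -/
private theorem ladderBbbt_diff_lower {x e f : ℝ} (k : ℕ) (hx0 : 0 ≤ x) (hx : x ≤ 1 / 2)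
    (he0 : 0 ≤ e) (hf0 : 0 ≤ f) (hf : f ≤ 1 / 6) :
    4 * x * ((1 + x + e) * (1 + x + f) * (1 + x) ^ k) ≤
      ((1 + x + e) * (1 + x + f) * (1 + x) ^ k - (1 - x - e) * (1 - x - f) * (1 - x) ^ k) *
        (1 + x) ^ 2 := by
  have h1 : (1 - x - e) * (1 + x) ≤ (1 + x + e) * (1 - x) := by nlinarith
  have h2 : (1 - x - f) * (1 + x) ≤ (1 + x + f) * (1 - x) := by nlinarith
  have h3 : (1 - x) ^ k ≤ (1 + x) ^ k := pow_le_pow_left₀ (by linarith) (by linarith) k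
  have key : (1 - x - e) * (1 + x) * ((1 - x - f) * (1 + x)) * (1 - x) ^ k ≤
      (1 + x + e) * (1 - x) * ((1 + x + f) * (1 - x)) * (1 + x) ^ k :=
    mul_le_mul (mul_le_mul h1 h2 (mul_nonneg (by linarith) (by linarith))
      (mul_nonneg (by linarith) (by linarith))) h3 (pow_nonneg (by linarith) k)
      (mul_nonneg (mul_nonneg (by linarith) (by linarith)) (mul_nonneg (by linarith) (by linarith)))
  nlinarith [key]

/-- The scalar inequality `x^{2m+2} (1+x)^{2m+2} ((1+x)² + (1-x)²) ≤ 4x` on `[0, 1/2]`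
(`(x(1+x))^{2m+2} ≤ (x(1+x))²` and `x (1+x)² (2 + 2x²) ≤ 45/16 ≤ 4`). [folklore] -/
private theorem ladderBbbt_scalar {x : ℝ} (m : ℕ) (hx0 : 0 ≤ x) (hx : x ≤ 1 / 2) :
    x ^ (2 * m + 2) * (1 + x) ^ (2 * m + 2) * ((1 + x) ^ 2 + (1 - x) ^ 2) ≤ 4 * x := by
  rw [← mul_pow]
  have hx2 := ladderBbbt_pow_le hx0 hx 2
  have hx3 := ladderBbbt_pow_le hx0 hx 3
  have hx4 := ladderBbbt_pow_le hx0 hx 4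
  have hx5 := ladderBbbt_pow_le hx0 hx 5
  norm_num at hx2 hx3 hx4 hx5
  have h0 : 0 ≤ x * (1 + x) := mul_nonneg hx0 (by linarith)
  have h1 : x * (1 + x) ≤ 1 := by nlinarith
  have hpow : (x * (1 + x)) ^ (2 * m + 2) ≤ (x * (1 + x)) ^ 2 :=
    pow_le_pow_of_le_one h0 h1 (by omega)
  have hlin : x * (1 + x) ^ 2 * ((1 + x) ^ 2 + (1 - x) ^ 2) ≤ 4 := by nlinarith
  calc (x * (1 + x)) ^ (2 * m + 2) * ((1 + x) ^ 2 + (1 - x) ^ 2)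
      ≤ (x * (1 + x)) ^ 2 * ((1 + x) ^ 2 + (1 - x) ^ 2) :=
        mul_le_mul_of_nonneg_right hpow (by positivity)
    _ = x * (x * (1 + x) ^ 2 * ((1 + x) ^ 2 + (1 - x) ^ 2)) := by ring
    _ ≤ x * 4 := mul_le_mul_of_nonneg_left hlin hx0
    _ = 4 * x := by ring

/-- The real inequality behind `stub_ladder_bbbt_adjacent`, in the rank-two variables
`e₁ = E_{c₁}`, `e₂ = E_{c₂}`, `e₃ = E_{c₃}`, `f₂ = E_{L-c₂}`, `f₃ = E_{L-c₃}`, `f₄ = E_{L-c₄}`,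
spans `c₂ - c₁ = u+1`, `c₃ - c₂ = m+1`, `c₄ - c₃ = w+1`. [folklore] -/
private theorem ladderBbbt_real {x e₁ e₂ e₃ f₂ f₃ f₄ : ℝ} (u m w : ℕ) (hx0 : 0 ≤ x)
    (hx : x ≤ 1 / 2) (he₁ : 0 ≤ e₁) (he₁' : e₁ ≤ 1 / 6) (he₂ : 0 ≤ e₂) (he₂' : e₂ ≤ 1 / 6)
    (he₃ : 0 ≤ e₃) (hf₂ : 0 ≤ f₂) (hf₂' : f₂ ≤ 1 / 6) (hf₃ : 0 ≤ f₃) (hf₃' : f₃ ≤ 1 / 6)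
    (hf₄ : 0 ≤ f₄) (hf₄' : f₄ ≤ 1 / 6) (h₂₃ : e₂ ≤ e₃) (h₃₂ : f₃ ≤ f₂) :
    x ^ (u + m + 1 + 1) / 2 *
          ((1 + x + e₁) * (1 + x + f₃) * (1 + x) ^ (u + m + 1) +
            (1 - x - e₁) * (1 - x - f₃) * (1 - x) ^ (u + m + 1)) *
        (x ^ (m + w + 1 + 1) / 2 *
          ((1 + x + e₂) * (1 + x + f₄) * (1 + x) ^ (m + w + 1) -
            (1 - x - e₂) * (1 - x - f₄) * (1 - x) ^ (m + w + 1))) ≤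
      x ^ (u + 1) / 2 *
          ((1 + x + e₁) * (1 + x + f₂) * (1 + x) ^ u + (1 - x - e₁) * (1 - x - f₂) * (1 - x) ^ u) *
        (x ^ (w + 1) / 2 *
          ((1 + x + e₃) * (1 + x + f₄) * (1 + x) ^ w -
            (1 - x - e₃) * (1 - x - f₄) * (1 - x) ^ w)) := by
  have hP : 0 ≤ 1 + x := by linarith
  have hP4 : 0 < (1 + x) ^ 4 := by positivity
  -- the two crossing brackets from above, the two adjacent brackets from below
  have U13 := ladderBbbt_bracket_upper (u + m + 1) hx0 hx he₁ hf₃ hf₃'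
  have U24 : (1 + x + e₂) * (1 + x + f₄) * (1 + x) ^ (m + w + 1) -
        (1 - x - e₂) * (1 - x - f₄) * (1 - x) ^ (m + w + 1) ≤
      (1 + x + e₃) * (1 + x + f₄) * (1 + x) ^ (m + w + 1) :=
    (ladderBbbt_diff_upper (m + w + 1) hx he₂' hf₄').trans
      (mul_le_mul_of_nonneg_right (mul_le_mul_of_nonneg_right (by linarith) (by linarith))
        (pow_nonneg hP _))
  have D24 := ladderBbbt_diff_nonneg (m + w + 1) hx0 hx he₂ hf₄ hf₄'
  have L12 := ladderBbbt_bracket_lower u hx he₁' hf₂'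
  have L34 := ladderBbbt_diff_lower w hx0 hx he₃ hf₄ hf₄'
  have B12 := ladderBbbt_bracket_nonneg u hx0 hx he₁ he₁' hf₂ hf₂'
  have A13 := ladderBbbt_main_nonneg (u + m + 1) hx0 he₁ hf₃
  have A34 : 0 ≤ 4 * x * ((1 + x + e₃) * (1 + x + f₄) * (1 + x) ^ w) :=
    mul_nonneg (by positivity) (ladderBbbt_main_nonneg w hx0 he₃ hf₄)
  -- the key comparison of the middle factors
  have key : x ^ (2 * m + 2) * (1 + x) ^ (2 * m + 2) * ((1 + x) ^ 2 + (1 - x) ^ 2) *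
        (1 + x + f₃) ≤ 4 * x * (1 + x + f₂) :=
    mul_le_mul (ladderBbbt_scalar m hx0 hx) (by linarith) (by linarith) (by positivity)
  refine le_of_mul_le_mul_right ?_ hP4
  calc x ^ (u + m + 1 + 1) / 2 *
          ((1 + x + e₁) * (1 + x + f₃) * (1 + x) ^ (u + m + 1) +
            (1 - x - e₁) * (1 - x - f₃) * (1 - x) ^ (u + m + 1)) *
        (x ^ (m + w + 1 + 1) / 2 *
          ((1 + x + e₂) * (1 + x + f₄) * (1 + x) ^ (m + w + 1) -
            (1 - x - e₂) * (1 - x - f₄) * (1 - x) ^ (m + w + 1))) * (1 + x) ^ 4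
      = x ^ (u + m + 1 + 1) / 2 * (x ^ (m + w + 1 + 1) / 2) *
          (((1 + x + e₁) * (1 + x + f₃) * (1 + x) ^ (u + m + 1) +
              (1 - x - e₁) * (1 - x - f₃) * (1 - x) ^ (u + m + 1)) * (1 + x) ^ 2 *
            ((1 + x + e₂) * (1 + x + f₄) * (1 + x) ^ (m + w + 1) -
              (1 - x - e₂) * (1 - x - f₄) * (1 - x) ^ (m + w + 1))) * (1 + x) ^ 2 := by ring
    _ ≤ x ^ (u + m + 1 + 1) / 2 * (x ^ (m + w + 1 + 1) / 2) *
          ((1 + x + e₁) * (1 + x + f₃) * (1 + x) ^ (u + m + 1) * ((1 + x) ^ 2 + (1 - x) ^ 2) *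
            ((1 + x + e₃) * (1 + x + f₄) * (1 + x) ^ (m + w + 1))) * (1 + x) ^ 2 :=
        mul_le_mul_of_nonneg_right
          (mul_le_mul_of_nonneg_left (mul_le_mul U13 U24 D24 (mul_nonneg A13 (by positivity)))
            (by positivity))
          (by positivity)
    _ = x ^ (u + 1) * x ^ (w + 1) / 4 * ((1 + x + e₁) * (1 + x + e₃) * (1 + x + f₄)) *
          (1 + x) ^ (u + w) * (1 + x) ^ 2 *
          (x ^ (2 * m + 2) * (1 + x) ^ (2 * m + 2) * ((1 + x) ^ 2 + (1 - x) ^ 2) *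
            (1 + x + f₃)) := by ring
    _ ≤ x ^ (u + 1) * x ^ (w + 1) / 4 * ((1 + x + e₁) * (1 + x + e₃) * (1 + x + f₄)) *
          (1 + x) ^ (u + w) * (1 + x) ^ 2 * (4 * x * (1 + x + f₂)) :=
        mul_le_mul_of_nonneg_left key (by positivity)
    _ = x ^ (u + 1) / 2 * (x ^ (w + 1) / 2) *
          ((1 + x + e₁) * (1 + x + f₂) * (1 + x) ^ u *
            (4 * x * ((1 + x + e₃) * (1 + x + f₄) * (1 + x) ^ w))) * (1 + x) ^ 2 := by ring
    _ ≤ x ^ (u + 1) / 2 * (x ^ (w + 1) / 2) *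
          (((1 + x + e₁) * (1 + x + f₂) * (1 + x) ^ u +
              (1 - x - e₁) * (1 - x - f₂) * (1 - x) ^ u) *
            (((1 + x + e₃) * (1 + x + f₄) * (1 + x) ^ w -
                (1 - x - e₃) * (1 - x - f₄) * (1 - x) ^ w) * (1 + x) ^ 2)) * (1 + x) ^ 2 :=
        mul_le_mul_of_nonneg_right
          (mul_le_mul_of_nonneg_left (mul_le_mul L12 L34 A34 B12) (by positivity)) (by positivity)
    _ = x ^ (u + 1) / 2 *
          ((1 + x + e₁) * (1 + x + f₂) * (1 + x) ^ u + (1 - x - e₁) * (1 - x - f₂) * (1 - x) ^ u) *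
        (x ^ (w + 1) / 2 *
          ((1 + x + e₃) * (1 + x + f₄) * (1 + x) ^ w -
            (1 - x - e₃) * (1 - x - f₄) * (1 - x) ^ w)) * (1 + x) ^ 4 := by ring

/-! ## The stub -/

/-- **Tool stub `stub_ladder_bbbt_adjacent`.** On the ladder `{0..L}×{0,1}`, for bottom sites
`(c₁,0), (c₂,0), (c₃,0)` and a top site `(c₄,1)` with `c₁ < c₂ < c₃ < c₄ ≤ L`, and `0 ≤ x ≤ 1/2`:
the crossing pairing weighs at most the ADJACENT one,
`Z((c₁,0),(c₃,0)) Z((c₂,0),(c₄,1)) ≤ Z((c₁,0),(c₂,0)) Z((c₃,0),(c₄,1))`. Mechanism: in the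
rank-two form of the kernels (`ladderBbbt_kernel_same`, `ladderBbbt_kernel_mixed`) the crossing
product carries the extra factor `(x(1+x))^{2(c₃-c₂)}`, the same-row bracket ratio is at most
`((1+x)² + (1-x)²)/(1+x)²`, the mixed bracket ratio at most `(1+x)²/(4x)`, and
`(x(1+x))² ((1+x)²+(1-x)²) ≤ 4x` on `[0, 1/2]`; the end corrections `E_k` only help (`E` is
monotone in `k`). [folklore] -/
theorem stub_ladder_bbbt_adjacent (L : ℕ) {c₁ c₂ c₃ c₄ : ℕ} (h₁₂ : c₁ < c₂) (h₂₃ : c₂ < c₃) (h₃₄ : c₃ < c₄)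
    (h₄ : c₄ ≤ L) {x : ℝ} (hx0 : 0 ≤ x) (hx : x ≤ 1 / 2) :
    pathKernel (discreteDomainGraph (rectDomain L 1) 1) x (st c₁ 0) (st c₃ 0) *
        pathKernel (discreteDomainGraph (rectDomain L 1) 1) x (st c₂ 0) (st c₄ 1) ≤
      pathKernel (discreteDomainGraph (rectDomain L 1) 1) x (st c₁ 0) (st c₂ 0) *
        pathKernel (discreteDomainGraph (rectDomain L 1) 1) x (st c₃ 0) (st c₄ 1) := by
  obtain ⟨u, hu⟩ : ∃ u, c₂ = c₁ + u + 1 := ⟨c₂ - c₁ - 1, by omega⟩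
  obtain ⟨m, hm⟩ : ∃ m, c₃ = c₂ + m + 1 := ⟨c₃ - c₂ - 1, by omega⟩
  obtain ⟨w, hw⟩ : ∃ w, c₄ = c₃ + w + 1 := ⟨c₄ - c₃ - 1, by omega⟩
  have hE := fun k => ladderBbbt_E_nonneg hx0 k
  have hE' := fun k => ladderBbbt_E_le hx0 hx k
  rw [ladderBbbt_kernel_same L c₁ c₃ (u + m + 1) (by omega) (by omega) hx0,
    ladderBbbt_kernel_mixed L c₂ c₄ (m + w + 1) (by omega) h₄ hx0,
    ladderBbbt_kernel_same L c₁ c₂ u (by omega) (by omega) hx0,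
    ladderBbbt_kernel_mixed L c₃ c₄ w (by omega) h₄ hx0,
    ← ENNReal.ofReal_mul
      (ladderBbbt_form_nonneg (u + m + 1) hx0 hx (hE c₁) (hE' c₁) (hE (L - c₃)) (hE' (L - c₃))),
    ← ENNReal.ofReal_mul
      (ladderBbbt_form_nonneg u hx0 hx (hE c₁) (hE' c₁) (hE (L - c₂)) (hE' (L - c₂)))]
  exact ENNReal.ofReal_le_ofReal (ladderBbbt_real u m w hx0 hx (hE c₁) (hE' c₁) (hE c₂) (hE' c₂)
    (hE c₃) (hE (L - c₂)) (hE' (L - c₂)) (hE (L - c₃)) (hE' (L - c₃)) (hE (L - c₄)) (hE' (L - c₄))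
    (ladderBbbt_E_mono hx0 (by omega : c₂ ≤ c₃)) (ladderBbbt_E_mono hx0 (by omega : L - c₃ ≤ L - c₂)))

end Summit.CriticalPhenomena.SAWScalingLimit.Theorems.BoundaryTP2
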